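import Summits.QuantumFields.YangMills.Theorems.CurvatureAmnesia.Negative.ModelBlindFalse
import Summits.QuantumFields.YangMills.Theorems.CurvatureAmnesia.Negative.TwoPointShadow
import Literature.MathematicalPhysics.QuantumFieldTheory.IsotropicOSFamilyExists

/-!
# Disproof of `CurvatureAmnesia` (crux stmt-QuantumFields-16192) — findings of the standing disprover, cycle 1

WORK FILE (refuter, cdisprove; `sorry` allowed only in §7). v3 (end of cycle 1): everything conclusive has LANDED and is now
IMPORTED instead of restated — `Theorems/CurvatureAmnesia/Negative/Unbundled.lean` (p147079: §0 unbundling `curvatureAmnesia_iff`,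
§1 `CurvatureAmnesiaModelBlind`, §6 `latticeGapWitness_of_not_curvatureAmnesia`), `…/SigmaFiveRotation.lean` (p146959: §3 `Rσ`,
`no_fit_sigmaFive`, `J_RσF₀`), `…/ModelBlindFalse.lean` (p149494: §4 `blind_*`, §5 `curvatureAmnesiaModelBlind_false_of`,
`…_of_exists`), `…/TwoPointShadow.lean` (p150439: §8 `not_twoPointShadow`), and the hypothesis `H` as the Literature named fact
`Literature.MathematicalPhysics.QuantumFieldTheory.IsotropicOSFamilyExists` (p149025). Section numbers below refer to those files;
this file keeps only the findings, the chain of weakenings and the near-misses (§7).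

## Read-back (W.lean rc 0; both route copies `Iff.rfl`, `curvatureAmnesia_scalingWindowSplit_iff`)

`CurvatureAmnesia` = ∀ compact simple `G` (`IsSimpleCompactGroup ∧ Nonempty LatticeRep`, Borel σ-algebra inlined),
∀ faithful `r`, ∀ scheme `sch` (free data `a_k > 0 → 0`, `a_k L_k → ∞`, `β`, `c`, `m`), ∀ labelled family `S` over ALL
gauge-invariant species: `β_k → ∞` → `OSBlock S` (E0, E0h, E0', E2, E3, E4 as typed; translations and det-1 signed
permutations on `⁰𝒮`) → `Tie r sch S` (every renormalised Wilson string converges to `S` on off-diagonal REAL tensors,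
`n ≠ 0`) → `CurvNontrivial S r.curvature` → `(∃ Δ > 0, S.HasMassGap Δ ∧ HasLatticeMassGap r sch Δ)` →
`SigmaFive S r.curvature` (§0, definitional). No junk operators; quantifier order faithful; degrees `0, 1` of the
conclusion are harmless (degree `1` needs translation invariance ⇒ `const · dx`).

## Findings

1. **No unconditional kill is possible today** (§6 `latticeGapWitness_of_not_curvatureAmnesia`, pure logic): a
   refutation exhibits a compact simple `G`, a faithful `r` and a scheme with `β_k → ∞` carrying `HasLatticeMassGap r sch Δ`,
   `Δ > 0` — volume-uniform exponential clustering of ALL gauge-invariant lattice observables at arbitrarily weak coupling,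
   i.e. Chatterjee's open weak-coupling lattice mass-gap problem. Every inhabitant of the hypothesis set needs it, including
   the vacuum family tied to a `c ≡ 0` scheme.
2. **Junk routes are closed by the TIE, not by weak coupling or non-triviality.** `β ≡ 0` / bounded `β` is excluded by
   `HasWeakCouplingLimit` (the reason the item was re-typed from stmt-8645); but even without it a family TIED to a `β ≡ 0`
   scheme is ultralocal on `⁰𝒮`: `c ≡ 0` ⇒ `S = 0` on off-diagonal real tensors in every positive degree ⇒ `CurvNontrivial`
   fails (landed: `CurvatureBoostCovariance.Negative.tie_apply_eq_zero_of_c_eq_zero`); `c ≠ 0` ⇒ a c-number limit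
   (`BetaZeroTie.tie_beta_zero_factorises`), Euclidean invariant. So `HasWeakCouplingLimit` and `CurvNontrivial` are NOT
   separately load-bearing for refutability; dropping EITHER leaves the crux exactly as unrefutable. Information for provers:
   on `⁰𝒮` the tie pins `S` completely (separated real tensors are total, `birth.lean` stub S2), so E0h/E2/E3/E4/
   translations/hypercubic invariance are CONSEQUENCES of the tie wherever they are evaluated — the crux is "Σ5-invariance of
   weak-coupling Wilson scaling limits of `tr F²` strings at separated points, given a uniform lattice gap".
3. **The model-blind form is FALSE modulo `H`** (§5 `curvatureAmnesiaModelBlind_false_of`, `…_of_exists`; sorry-free,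
   axioms `propext, Classical.choice, Quot.sound`). `CurvatureAmnesiaModelBlind` = the crux with the tie and the lattice gap
   deleted (weak coupling, the whole OS block, non-triviality and the continuum gap KEPT). Witness: `G = SU(2)`,
   fundamental `r`, `β_k = k`, `S = S_iso + J'` with `J'` the degree-4 junk `J` of `NPointIsotropy.Negative`
   (`W(B₄) × S₄`-symmetrised integral over the 7-plane `(x, x+se₃, x+te₂, x+re₀)`): `J` vanishes on every time-separated
   configuration, so every OS clause, the gap and non-triviality of `S_iso + J'` are those of `S_iso` (§4 `blind_*`), and
   `J (R·F₀) = 0 ≠ J F₀` for the Σ5 rotation `R` (§3 `no_fit_sigmaFive`). `H` = ONE non-trivial, massive, fully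
   isometry-invariant one-field OS family (the free massive field) — TRUE, not yet constructible in the tree (§7).
   MORAL: the Wilson tie is load-bearing for every proof; weak coupling + non-triviality + both gaps + RP + the sixteen
   signed-permutation symmetries do not force Σ5-blindness of `𝔖₄`.
5. **Two-point shadow, UNCONDITIONAL** (§8 `not_twoPointShadow`): the kernel `K(z) = e^{−‖z‖₁}` — two-point
   function of the `W(B₄)`-symmetric generalised free field `∏_μ (1 − ∂_μ²)⁻¹` — is continuous, even, invariant under
   all signed permutations, reflection positive at positive times (OU kernel `e^{−|s−t|}` positive definite, from the
   tree's Lorentzian Fourier integral; Schur products), exponentially clustering in time, non-zero, and NOT Σ5-invariant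
   (`K(R e₂) = e^{−7/5} ≠ e^{−1}`): already in degree two nothing short of the tie constrains the angular dependence.
4. **Tightness of the weakenings** (§7): `CurvatureAmnesiaWithoutTie` (tie deleted, lattice gap KEPT) is NOT refutable
   today — its refutation = the witness of (3) + a weak-coupling uniformly gapped Wilson scheme (open, as in (1)).

## Attacks tried (all recorded in the seat's NOTES.md §Census)
junk `G` (excluded by `IsCompactSimpleLieGroup`); `β ≡ 0`, bounded `β`, `c ≡ 0`, vacuum, c-number limits (2); product of
four telegraph/OU processes `∏ Y^μ(x^μ)` (covariance `e^{−λ‖x‖₁}`: W(B₄)-invariant, RP, not Σ5 — but E4 FAILS at degree 4,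
hyperplane-shared modes); truncated degree-2 families (E4/E2 fail); finite sums of RP fields (E4 fails); the honest
anisotropic model is the generalised free field with covariance `∏_μ e^{−m|x^μ|}` (all clauses hold on paper; its Lean
construction needs the hafnian/Fock RP argument, ≈ the same infrastructure as `H`).
-/

noncomputable section

-- Mathlib's `SimplexCategory` instance `Fintype (Fin (x.len + 1))` matches `Fintype (Fin 4)` and makes concrete
-- `Fin 4` instance paths diverge between elaborations (tree-known workaround, cf. `NPointIsotropy.Negative`).
attribute [-instance] SimplexCategory.instFintypeToTypeOrderHomFinHAddNatLenOfNat

namespace Summit.QuantumFields.YangMills.Cruxes.CurvatureAmnesia.Disproof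

open scoped BigOperators SchwartzMap
open MeasureTheory Filter Topology
open Literature.MathematicalPhysics.QuantumLattice Literature.MathematicalPhysics.AQFT
  Literature.MathematicalPhysics.QuantumFieldTheory
open Summit.QuantumFields.YangMills.Theorems.NPointIsotropy.Negative
open Summit.QuantumFields.YangMills.Theorems.CurvatureAmnesia.Negative

/-! ## §A What has landed (re-exported by name, for readers of this file) -/

/-- Finding 1 (refutation cost), landed: `¬ crux` exhibits a compact simple `G` with a weak-coupling, volume-uniformly
gapped Wilson scheme. -/
example := @latticeGapWitness_of_not_curvatureAmnesia

/-- Finding 3 (model-blind form false modulo `H`), landed. -/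
example : IsotropicOSFamilyExists → ¬ CurvatureAmnesiaModelBlind :=
  fun h => curvatureAmnesiaModelBlind_false_of_exists h

/-- Finding 5 (two-point shadow false, unconditional), landed. -/
example : ¬ TwoPointShadow := not_twoPointShadow

/-- The chain of weakenings, landed direction: `ModelBlind → crux`. -/
example : CurvatureAmnesiaModelBlind →
    Summit.QuantumFields.YangMills.Theses.CoincidenceRotationBootstrap.CurvatureAmnesia :=
  curvatureAmnesia_of_modelBlind

/-! ## §7 Near-misses (sorry permitted ONLY here) and the intermediate weakening -/

/-- **NEAR-MISS (`H` itself).** The free massive scalar field on `ℝ⁴` as a one-field OS family with the typed clauses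
(`Literature.MathematicalPhysics.QuantumFieldTheory.IsotropicOSFamilyExists`, registered Literature debt).
OBSTRUCTION / INVENTORY: the tree has the free-field MEASURE with measure-form OS axioms (`freeFieldMeasure_spec_holds`,
`IsFreeField.isOSMeasure_holds`), a Schwinger family with the ONE-FIELD `IsOSFamily` (`IsOSMeasure.exists_isOSFamily'_holds`),
E0' via `IsOSMeasure.hasProductGrowth` + `HasProductGrowth.hasLinearGrowth_holds`, TWO-point clustering
(`IsFreeField.hasExponentialClustering_holds`) and `IsFreeField.twoPoint_eq_holds`; MISSING: (i) bridges one-field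
`ℕ`-indexed E2/E4 (`IsPositiveTimeMulti`) → labelled `Fin N`-indexed forms on time-ORDERED data (regroup by degree,
dependent casts), (ii) E0h from reality + E3 + E1, (iii) exponential clustering of ALL truncations
`𝔖ₙ₊ₘ(θF* ⊗ T_t G) − 𝔖ₙ(θF*)𝔖ₘ(G)` of the Gaussian family (Wick expansion: every surviving term has a cross pair
`= O(e^{−mt})`), (iv) `C(θf,f) > 0` for one bump. Estimated 600–1200 lines; a literature-prover task. -/
theorem isotropicOSFamilyExists_nearMiss : IsotropicOSFamilyExists := by
  sorry

/-- What finding 3 becomes once `H` is discharged: the model-blind form is false outright. -/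
theorem curvatureAmnesiaModelBlind_false : ¬ CurvatureAmnesiaModelBlind :=
  curvatureAmnesiaModelBlind_false_of_exists isotropicOSFamilyExists_nearMiss

/-- **The crux without the tie ONLY** (the uniform lattice gap `HasLatticeMassGap r sch Δ` KEPT, weak coupling kept):
the intermediate weakening between `CurvatureAmnesiaModelBlind` and the crux. -/
def CurvatureAmnesiaWithoutTie : Prop :=
  ∀ (G : Type) [Group G] [TopologicalSpace G] [IsTopologicalGroup G] [CompactSpace G],
    IsCompactSimpleLieGroup G →
    letI : MeasurableSpace G := borel G
    haveI : BorelSpace G := ⟨rfl⟩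
    ∀ (r : LatticeRep G) (sch : SpeciesScheme (YMSpecies G)) (S : LabelledSchwingerFamily (YMSpecies G) E4),
      sch.HasWeakCouplingLimit → OSBlock S → CurvNontrivial S r.curvature →
        (∃ Δ : ℝ, 0 < Δ ∧ S.HasMassGap Δ ∧ HasLatticeMassGap r sch Δ) → SigmaFive S r.curvature

/-- `ModelBlind → WithoutTie`. [folklore] -/
theorem withoutTie_of_modelBlind (h : CurvatureAmnesiaModelBlind) : CurvatureAmnesiaWithoutTie := by
  intro G _ _ _ _ hG r sch S hw hOS hN hgap
  obtain ⟨Δ, hΔ, hS, -⟩ := hgap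
  exact h G hG r sch S hw hOS hN ⟨Δ, hΔ, hS⟩

/-- `WithoutTie → crux`. [folklore] -/
theorem curvatureAmnesia_of_withoutTie (h : CurvatureAmnesiaWithoutTie) :
    Summit.QuantumFields.YangMills.Theses.CoincidenceRotationBootstrap.CurvatureAmnesia := by
  rw [curvatureAmnesia_iff]
  intro G _ _ _ _ hG r sch S hw hOS _ hN hgap
  exact h G hG r sch S hw hOS hN hgap

/-- **NEAR-MISS (tightness of the weakening).** `CurvatureAmnesiaWithoutTie` should be false with the SAME witness family
`S_iso + J'` — but the kept clause `HasLatticeMassGap r sch Δ` at `β_k → ∞` must then be inhabited by an honest Wilson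
scheme: a weak-coupling, volume-uniformly gapped lattice Yang–Mills theory for some compact simple `G` (finding 1; open).
Recorded so that provers know the lattice GAP is not what protects the crux from junk — the tie is. -/
theorem curvatureAmnesia_false_without_tie : ¬ CurvatureAmnesiaWithoutTie := by
  sorry

end Summit.QuantumFields.YangMills.Cruxes.CurvatureAmnesia.Disproof

end
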